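import Summits.NavierStokesRegularity.NavierStokesRegularity.Theorems.PerpetualPumpCircuitTraceValveBudgetIdentity
import HarnessLib

/-!
# `PerpetualPump.CircuitTrace`, line `tilted-trace-gronwall`, stub S1 (valve budget) — part II:
# block energy identity and the pointwise burn rate above a quiet valve

Helper file for crux stmt-NavierStokesRegularity-1836 (`PerpetualPump.CircuitTrace`), supporting the lead's stub
`stub_valveBudget` (part III, `PerpetualPumpCircuitTraceValveBudget.lean`). Units: critical amplitude
`a_{i,n} = lam^{n/5}|X_{i,n}|`, clock of scale `n` = `lam^{4n/5}`, scale energy `e_j = Σ_i X_{i,j}²`, triad flux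
`π_b = 2 lam^b Σ coeff(i₁,i₂,i₃,some 2) X_{i₁,b} X_{i₂,b} X_{i₃,b+1}`.

* `valveBudget_block_hasDerivAt`: the per-scale identity (part I) telescopes over the block `n+1..n+L`:
  `ℰ_L' = -Σ 2lam^{4j/5} e_j + π_n - π_{n+L}`.
* `valveBudget_pointwise` (registered sub-goal): at an instant where the valve `n` is `δ`-quiet, a mode
  `(i*,j*)` with `n < j* ≤ n+L` is `δ`-active, `m K² m⁴ lam^{-6/5} δ² ≤ 1/2` and `|π_{n+L}| ≤ ε`, the block energy
  burns at rate `≥ (δ²/2) lam^{2(n+1)/5} - ε`. The LEAK `|π_n| ≤ 2Km²δ²lam^{3n/5}Σ_i|X_{i,n+1}|` is absorbed by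
  the dissipation of scale `n+1` itself (`2Q|x| ≤ P x² + Q²/P`, excess `m Q²/P ≤ lam^{2(n+1)/5} δ²/2`), which is
  why no smallness condition on `m, K, M, lam` is needed — the point raised in §6 of the disprover's
  `Cruxes/CircuitTrace/Disproof.lean`.
-/

noncomputable section

-- the nested summit namespace `…NavierStokesRegularity.NavierStokesRegularity…` is the tree's layout (D-0017)
set_option linter.dupNamespace false

namespace Summit.NavierStokesRegularity.NavierStokesRegularity.Theorems.PerpetualPumpCircuitTrace

open Finset Real Set
open Summit.NavierStokesRegularity.NavierStokesRegularity.Theorems.CircuitTrace.Negative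

/-! ## Block energy: telescoping of the triad fluxes -/

/-- **Block energy identity.** For a cyclic circuit solved at time `t`, the energy of the block of scales
`n+1, …, n+L` has derivative `-(Σ_{l<L} 2 lam^{4(n+1+l)/5} e_{n+1+l}) + π_n - π_{n+L}`: the interior fluxes
telescope, only the flux INTO the block through the cut `n | n+1` and OUT through `n+L | n+L+1` remain. [folklore] -/
theorem valveBudget_block_hasDerivAt {lam : ℝ} {m : ℕ}
    {coeff : Fin m → Fin m → Fin m → Option (Fin 3) → ℝ} (hcyc : IsCyclic coeff)
    (X : Fin m → ℤ → ℝ → ℝ) (n : ℤ) (L : ℕ) (t : ℝ)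
    (hX : ∀ (i : Fin m) (j : ℤ), HasDerivAt (X i j) (circuitRHS lam coeff X i j t) t) :
    HasDerivAt (fun s => ∑ l ∈ Finset.range L, ∑ i : Fin m, (X i (n + 1 + l) s) ^ 2)
      (-(∑ l ∈ Finset.range L, 2 * lam ^ ((4 / 5 : ℝ) * ((n + 1 + l : ℤ) : ℝ)) *
            ∑ i : Fin m, (X i (n + 1 + l) t) ^ 2)
        + 2 * lam ^ ((n : ℤ) : ℝ) * (∑ i₁ : Fin m, ∑ i₂ : Fin m, ∑ i₃ : Fin m,
            coeff i₁ i₂ i₃ (some 2) * X i₁ n t * X i₂ n t * X i₃ (n + 1) t)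
        - 2 * lam ^ ((n + L : ℤ) : ℝ) * (∑ i₁ : Fin m, ∑ i₂ : Fin m, ∑ i₃ : Fin m,
            coeff i₁ i₂ i₃ (some 2) * X i₁ (n + L) t * X i₂ (n + L) t * X i₃ (n + L + 1) t)) t := by
  -- the flux through the cut `n+l | n+l+1`
  set F : ℕ → ℝ := fun l => 2 * lam ^ ((n + l : ℤ) : ℝ) * (∑ i₁ : Fin m, ∑ i₂ : Fin m, ∑ i₃ : Fin m,
      coeff i₁ i₂ i₃ (some 2) * X i₁ (n + l) t * X i₂ (n + l) t * X i₃ (n + l + 1) t) with hF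
  -- per-scale identity at scale n+1+l, fluxes rewritten as F l and F (l+1)
  have hscale : ∀ l ∈ Finset.range L,
      HasDerivAt (fun s => ∑ i : Fin m, (X i (n + 1 + l) s) ^ 2)
        (-(2 * lam ^ ((4 / 5 : ℝ) * ((n + 1 + l : ℤ) : ℝ)) * ∑ i : Fin m, (X i (n + 1 + l) t) ^ 2)
          + (F l - F (l + 1))) t := by
    intro l _
    have h := valveBudget_scale_identity lam m coeff hcyc X (n + 1 + l) t (fun i => hX i _)
    refine h.congr_deriv ?_
    have e1 : (n + 1 + (l : ℤ) - 1) = n + l := by ring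
    have e2 : (n + 1 + (l : ℤ)) = n + l + 1 := by ring
    have e3 : (n + 1 + (l : ℤ) + 1) = n + ((l + 1 : ℕ) : ℤ) + 1 := by push_cast; ring
    have e4 : (n + ((l + 1 : ℕ) : ℤ)) = n + 1 + l := by push_cast; ring
    have e5 : (((n + 1 + (l : ℤ) : ℤ)) : ℝ) - 1 = (((n + (l : ℤ) : ℤ)) : ℝ) := by push_cast; ring
    have e6 : (((n + 1 + (l : ℤ) : ℤ)) : ℝ) = (((n + ((l + 1 : ℕ) : ℤ) : ℤ)) : ℝ) := by push_cast; ring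
    rw [hF]
    simp only
    rw [e5, ← e6, e1, e4, e3]
    simp only [e2]
    ring
  have hsum := HasDerivAt.sum hscale
  have key : (fun s => ∑ l ∈ Finset.range L, ∑ i : Fin m, (X i (n + 1 + l) s) ^ 2)
      = ∑ l ∈ Finset.range L, fun s => ∑ i : Fin m, (X i (n + 1 + l) s) ^ 2 := by
    funext s
    simp [Finset.sum_apply]
  rw [key]
  refine hsum.congr_deriv ?_
  rw [Finset.sum_add_distrib, Finset.sum_range_sub', Finset.sum_neg_distrib]
  have hF0 : F 0 = 2 * lam ^ ((n : ℤ) : ℝ) * (∑ i₁ : Fin m, ∑ i₂ : Fin m, ∑ i₃ : Fin m,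
      coeff i₁ i₂ i₃ (some 2) * X i₁ n t * X i₂ n t * X i₃ (n + 1) t) := by
    rw [hF]
    simp
  rw [hF0, hF]
  simp only
  push_cast
  ring

/-! ## Elementary bounds -/

/-- The trilinear valve flux with two factors bounded by `B`: `|Σ c Y Y Z| ≤ K B² m² Σ|Z|`. [folklore] -/
theorem valveBudget_flux_abs_le {m : ℕ} (coeff : Fin m → Fin m → Fin m → Option (Fin 3) → ℝ) {K : ℝ}
    (hK0 : 0 ≤ K) (hK : ∀ i₁ i₂ i₃ μ, |coeff i₁ i₂ i₃ μ| ≤ K) (Y Z : Fin m → ℝ) {B : ℝ} (hB0 : 0 ≤ B)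
    (hB : ∀ i, |Y i| ≤ B) :
    |∑ i₁ : Fin m, ∑ i₂ : Fin m, ∑ i₃ : Fin m, coeff i₁ i₂ i₃ (some 2) * Y i₁ * Y i₂ * Z i₃|
      ≤ K * B ^ 2 * (m : ℝ) ^ 2 * ∑ i₃ : Fin m, |Z i₃| := by
  have hterm : ∀ i₁ i₂ i₃ : Fin m, |coeff i₁ i₂ i₃ (some 2) * Y i₁ * Y i₂ * Z i₃| ≤ K * B ^ 2 * |Z i₃| := by
    intro i₁ i₂ i₃
    rw [abs_mul, abs_mul, abs_mul]
    have h1 : |coeff i₁ i₂ i₃ (some 2)| * |Y i₁| ≤ K * B :=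
      mul_le_mul (hK _ _ _ _) (hB i₁) (abs_nonneg _) hK0
    have h2 : |coeff i₁ i₂ i₃ (some 2)| * |Y i₁| * |Y i₂| ≤ K * B * B :=
      mul_le_mul h1 (hB i₂) (abs_nonneg _) (mul_nonneg hK0 hB0)
    calc |coeff i₁ i₂ i₃ (some 2)| * |Y i₁| * |Y i₂| * |Z i₃| ≤ K * B * B * |Z i₃| :=
          mul_le_mul_of_nonneg_right h2 (abs_nonneg _)
      _ = K * B ^ 2 * |Z i₃| := by ring
  calc |∑ i₁ : Fin m, ∑ i₂ : Fin m, ∑ i₃ : Fin m, coeff i₁ i₂ i₃ (some 2) * Y i₁ * Y i₂ * Z i₃|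
      ≤ ∑ i₁ : Fin m, ∑ i₂ : Fin m, ∑ i₃ : Fin m, |coeff i₁ i₂ i₃ (some 2) * Y i₁ * Y i₂ * Z i₃| := by
        refine (Finset.abs_sum_le_sum_abs _ _).trans (Finset.sum_le_sum fun i₁ _ => ?_)
        refine (Finset.abs_sum_le_sum_abs _ _).trans (Finset.sum_le_sum fun i₂ _ => ?_)
        exact Finset.abs_sum_le_sum_abs _ _
    _ ≤ ∑ _i₁ : Fin m, ∑ _i₂ : Fin m, ∑ i₃ : Fin m, K * B ^ 2 * |Z i₃| :=
        Finset.sum_le_sum fun i₁ _ => Finset.sum_le_sum fun i₂ _ => Finset.sum_le_sum fun i₃ _ =>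
          hterm i₁ i₂ i₃
    _ = K * B ^ 2 * (m : ℝ) ^ 2 * ∑ i₃ : Fin m, |Z i₃| := by
        rw [Finset.sum_const, Finset.sum_const, Finset.card_univ, Fintype.card_fin, ← Finset.mul_sum]
        simp only [nsmul_eq_mul]
        ring

/-- Quadratic absorption: `2Q|x| ≤ P x² + Q²/P` for `P > 0`. [folklore] -/
theorem valveBudget_absorb {P Q x : ℝ} (hP : 0 < P) : 2 * Q * |x| ≤ P * x ^ 2 + Q ^ 2 / P := by
  have h : 0 ≤ (P * |x| - Q) ^ 2 / P := div_nonneg (sq_nonneg _) hP.le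
  have e : (P * |x| - Q) ^ 2 / P = P * x ^ 2 + Q ^ 2 / P - 2 * Q * |x| := by
    field_simp
    rw [← sq_abs x]
    ring
  linarith [h, e]

/-- Powers of `lam > 0` multiply by adding real exponents (restated for `rw` convenience). [folklore] -/
theorem valveBudget_rpow_mul_rpow {lam : ℝ} (hlam : 0 < lam) (a b : ℝ) :
    lam ^ a * lam ^ b = lam ^ (a + b) := (Real.rpow_add hlam a b).symm

/-- From a critical-amplitude bound to a plain bound: `lam^{e}|x| ≤ d ⇒ |x| ≤ d · lam^{-e}`. [folklore] -/
theorem valveBudget_abs_le_of_amp_le {lam : ℝ} (hlam : 0 < lam) {e d x : ℝ} (h : lam ^ e * |x| ≤ d) :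
    |x| ≤ d * lam ^ (-e) := by
  have hp : 0 < lam ^ e := Real.rpow_pos_of_pos hlam e
  rw [Real.rpow_neg hlam.le, ← div_eq_mul_inv, le_div_iff₀ hp, mul_comm]
  exact h

/-! ## The pointwise burn rate -/

/-- **Pointwise burn rate above a quiet valve.** At an instant `ξ` at which the valve scale `n` is `δ`-quiet,
some mode `(i*, j*)` with `n < j* ≤ n+L` is `δ`-active, the smallness `m K² m⁴ lam^{-6/5} δ² ≤ 1/2` holds and the
top flux is at most `ε`, the block energy of scales `n+1..n+L` burns at rate at least `(δ²/2) lam^{2(n+1)/5} - ε`: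
dissipation `≥ lam^{4(n+1)/5} e_{n+1} + lam^{4j*/5} X_{i*,j*}²`, leak `≤ lam^{4(n+1)/5} e_{n+1} + m Q²/P` by
quadratic absorption, active burn `≥ lam^{2(n+1)/5} δ²`. [folklore] -/
theorem valveBudget_pointwise :
    ∀ (lam : ℝ), 1 < lam → ∀ (m : ℕ) (coeff : Fin m → Fin m → Fin m → Option (Fin 3) → ℝ) (K : ℝ), 0 ≤ K →
    (∀ (i₁ i₂ i₃ : Fin m) (μ : Option (Fin 3)), |coeff i₁ i₂ i₃ μ| ≤ K) →
    ∀ (X : Fin m → ℤ → ℝ → ℝ) (n : ℤ) (L : ℕ) (ξ δ ε : ℝ), 0 ≤ δ →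
    (m : ℝ) * K ^ 2 * (m : ℝ) ^ 4 * lam ^ (-(6 / 5 : ℝ)) * δ ^ 2 ≤ 1 / 2 →
    (∀ i : Fin m, lam ^ ((1 / 5 : ℝ) * n) * |X i n ξ| ≤ δ) →
    (∃ (i : Fin m) (j : ℤ), n < j ∧ j ≤ n + L ∧ δ ≤ lam ^ ((1 / 5 : ℝ) * j) * |X i j ξ|) →
    |2 * lam ^ ((n + L : ℤ) : ℝ) * (∑ i₁ : Fin m, ∑ i₂ : Fin m, ∑ i₃ : Fin m,
        coeff i₁ i₂ i₃ (some 2) * X i₁ (n + L) ξ * X i₂ (n + L) ξ * X i₃ (n + L + 1) ξ)| ≤ ε →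
    -(∑ l ∈ Finset.range L, 2 * lam ^ ((4 / 5 : ℝ) * ((n + 1 + l : ℤ) : ℝ)) *
          ∑ i : Fin m, (X i (n + 1 + l) ξ) ^ 2)
      + 2 * lam ^ ((n : ℤ) : ℝ) * (∑ i₁ : Fin m, ∑ i₂ : Fin m, ∑ i₃ : Fin m,
          coeff i₁ i₂ i₃ (some 2) * X i₁ n ξ * X i₂ n ξ * X i₃ (n + 1) ξ)
      - 2 * lam ^ ((n + L : ℤ) : ℝ) * (∑ i₁ : Fin m, ∑ i₂ : Fin m, ∑ i₃ : Fin m,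
          coeff i₁ i₂ i₃ (some 2) * X i₁ (n + L) ξ * X i₂ (n + L) ξ * X i₃ (n + L + 1) ξ)
      ≤ -(δ ^ 2 / 2) * lam ^ ((2 / 5 : ℝ) * ((n : ℝ) + 1)) + ε := by
  intro lam hlam m coeff K hK0 hK X n L ξ δ ε hδ hsmall hvalve hact htop
  have hlam0 : 0 < lam := by linarith
  obtain ⟨iS, jS, hnj, hjL, hδa⟩ := hact
  -- the index of the active scale inside the block
  obtain ⟨lS, hlS⟩ : ∃ lS : ℕ, (lS : ℤ) = jS - n - 1 := ⟨(jS - n - 1).toNat, Int.toNat_of_nonneg (by omega)⟩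
  have hlSL : lS ∈ Finset.range L := by rw [Finset.mem_range]; omega
  have h0L : 0 ∈ Finset.range L := by rw [Finset.mem_range]; omega
  have hjS : n + 1 + (lS : ℤ) = jS := by omega
  -- abbreviations
  set P : ℝ := lam ^ ((4 / 5 : ℝ) * ((n : ℝ) + 1)) with hPdef
  have hP : 0 < P := Real.rpow_pos_of_pos hlam0 _
  set Q : ℝ := K * (m : ℝ) ^ 2 * δ ^ 2 * lam ^ ((3 / 5 : ℝ) * n) with hQdef
  set g : ℕ → ℝ := fun l => 2 * lam ^ ((4 / 5 : ℝ) * ((n + 1 + l : ℤ) : ℝ)) *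
      ∑ i : Fin m, (X i (n + 1 + l) ξ) ^ 2 with hgdef
  have hg0 : ∀ l, 0 ≤ g l := fun l => by
    rw [hgdef]
    exact mul_nonneg (mul_nonneg (by norm_num) (Real.rpow_pos_of_pos hlam0 _).le)
      (Finset.sum_nonneg fun i _ => sq_nonneg _)
  -- (1) dissipation ≥ P e_{n+1} + lam^{4j*/5} X_{i*,j*}²
  have hS0 : g 0 ≤ ∑ l ∈ Finset.range L, g l :=
    Finset.single_le_sum (fun l _ => hg0 l) h0L
  have hSl : g lS ≤ ∑ l ∈ Finset.range L, g l :=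
    Finset.single_le_sum (fun l _ => hg0 l) hlSL
  have hg0eq : g 0 = 2 * P * ∑ i : Fin m, (X i (n + 1) ξ) ^ 2 := by
    rw [hgdef, hPdef]
    simp only [Nat.cast_zero, add_zero]
    push_cast
    ring_nf
  have hglS : 2 * lam ^ ((4 / 5 : ℝ) * (jS : ℝ)) * (X iS jS ξ) ^ 2 ≤ g lS := by
    rw [hgdef]
    simp only [hjS]
    refine mul_le_mul_of_nonneg_left ?_ (mul_nonneg (by norm_num) (Real.rpow_pos_of_pos hlam0 _).le)
    exact Finset.single_le_sum (f := fun i => (X i jS ξ) ^ 2) (fun i _ => sq_nonneg _) (Finset.mem_univ iS)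
  -- (2) the active mode burns at least lam^{2(n+1)/5} δ²
  have hact' : δ ^ 2 * lam ^ ((2 / 5 : ℝ) * ((n : ℝ) + 1))
      ≤ lam ^ ((4 / 5 : ℝ) * (jS : ℝ)) * (X iS jS ξ) ^ 2 := by
    have hsq : δ ^ 2 ≤ (lam ^ ((1 / 5 : ℝ) * jS) * |X iS jS ξ|) ^ 2 := pow_le_pow_left₀ hδ hδa 2
    have e1 : (lam ^ ((1 / 5 : ℝ) * jS) * |X iS jS ξ|) ^ 2 = lam ^ ((2 / 5 : ℝ) * jS) * (X iS jS ξ) ^ 2 := by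
      rw [mul_pow, sq_abs, ← Real.rpow_natCast, ← Real.rpow_mul hlam0.le]
      congr 1; congr 1; push_cast; ring
    rw [e1] at hsq
    have hmono : lam ^ ((2 / 5 : ℝ) * ((n : ℝ) + 1)) ≤ lam ^ ((2 / 5 : ℝ) * jS) := by
      apply Real.rpow_le_rpow_of_exponent_le hlam.le
      have : ((n : ℝ) + 1) ≤ (jS : ℝ) := by exact_mod_cast hnj
      linarith
    have e2 : lam ^ ((4 / 5 : ℝ) * (jS : ℝ)) = lam ^ ((2 / 5 : ℝ) * jS) * lam ^ ((2 / 5 : ℝ) * jS) := by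
      rw [valveBudget_rpow_mul_rpow hlam0]; congr 1; ring
    rw [e2, mul_assoc]
    calc δ ^ 2 * lam ^ ((2 / 5 : ℝ) * ((n : ℝ) + 1))
        = lam ^ ((2 / 5 : ℝ) * ((n : ℝ) + 1)) * δ ^ 2 := mul_comm _ _
      _ ≤ lam ^ ((2 / 5 : ℝ) * jS) * (lam ^ ((2 / 5 : ℝ) * jS) * (X iS jS ξ) ^ 2) :=
          mul_le_mul hmono hsq (sq_nonneg _) (Real.rpow_pos_of_pos hlam0 _).le
  -- (3) the leak through the quiet valve
  have hXn : ∀ i : Fin m, |X i n ξ| ≤ δ * lam ^ (-((1 / 5 : ℝ) * n)) := fun i =>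
    valveBudget_abs_le_of_amp_le hlam0 (hvalve i)
  have hB0 : 0 ≤ δ * lam ^ (-((1 / 5 : ℝ) * n)) := mul_nonneg hδ (Real.rpow_pos_of_pos hlam0 _).le
  have hleak : |2 * lam ^ ((n : ℤ) : ℝ) * (∑ i₁ : Fin m, ∑ i₂ : Fin m, ∑ i₃ : Fin m,
        coeff i₁ i₂ i₃ (some 2) * X i₁ n ξ * X i₂ n ξ * X i₃ (n + 1) ξ)|
      ≤ ∑ i : Fin m, 2 * Q * |X i (n + 1) ξ| := by
    have h1 := valveBudget_flux_abs_le coeff hK0 hK (fun i => X i n ξ) (fun i => X i (n + 1) ξ) hB0 hXn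
    rw [abs_mul, abs_mul, abs_of_pos (show (0 : ℝ) < 2 by norm_num),
      abs_of_pos (Real.rpow_pos_of_pos hlam0 _), ← Finset.mul_sum]
    have e1 : 2 * lam ^ ((n : ℤ) : ℝ) * (K * (δ * lam ^ (-((1 / 5 : ℝ) * n))) ^ 2 * (m : ℝ) ^ 2
        * ∑ i₃ : Fin m, |X i₃ (n + 1) ξ|) = 2 * Q * ∑ i : Fin m, |X i (n + 1) ξ| := by
      rw [hQdef]
      have e2 : lam ^ ((n : ℤ) : ℝ) * (lam ^ (-((1 / 5 : ℝ) * n))) ^ 2 = lam ^ ((3 / 5 : ℝ) * n) := by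
        rw [← Real.rpow_natCast, ← Real.rpow_mul hlam0.le, valveBudget_rpow_mul_rpow hlam0]
        congr 1; push_cast; ring
      calc 2 * lam ^ ((n : ℤ) : ℝ) * (K * (δ * lam ^ (-((1 / 5 : ℝ) * n))) ^ 2 * (m : ℝ) ^ 2
            * ∑ i₃ : Fin m, |X i₃ (n + 1) ξ|)
          = 2 * (K * (m : ℝ) ^ 2 * δ ^ 2 * (lam ^ ((n : ℤ) : ℝ) * (lam ^ (-((1 / 5 : ℝ) * n))) ^ 2))
              * ∑ i₃ : Fin m, |X i₃ (n + 1) ξ| := by ring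
        _ = _ := by rw [e2]
    calc 2 * lam ^ ((n : ℤ) : ℝ) * |∑ i₁ : Fin m, ∑ i₂ : Fin m, ∑ i₃ : Fin m,
          coeff i₁ i₂ i₃ (some 2) * X i₁ n ξ * X i₂ n ξ * X i₃ (n + 1) ξ|
        ≤ 2 * lam ^ ((n : ℤ) : ℝ) * (K * (δ * lam ^ (-((1 / 5 : ℝ) * n))) ^ 2 * (m : ℝ) ^ 2
            * ∑ i₃ : Fin m, |X i₃ (n + 1) ξ|) :=
          mul_le_mul_of_nonneg_left h1 (mul_nonneg (by norm_num) (Real.rpow_pos_of_pos hlam0 _).le)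
      _ = 2 * Q * ∑ i : Fin m, |X i (n + 1) ξ| := e1
  -- (4) absorption of the leak by the dissipation of scale n+1
  have habs : ∑ i : Fin m, 2 * Q * |X i (n + 1) ξ|
      ≤ P * (∑ i : Fin m, (X i (n + 1) ξ) ^ 2) + (m : ℝ) * (Q ^ 2 / P) := by
    calc ∑ i : Fin m, 2 * Q * |X i (n + 1) ξ| ≤ ∑ i : Fin m, (P * (X i (n + 1) ξ) ^ 2 + Q ^ 2 / P) :=
          Finset.sum_le_sum fun i _ => valveBudget_absorb hP
      _ = P * (∑ i : Fin m, (X i (n + 1) ξ) ^ 2) + (m : ℝ) * (Q ^ 2 / P) := by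
          rw [Finset.sum_add_distrib, Finset.mul_sum, Finset.sum_const, Finset.card_univ, Fintype.card_fin,
            nsmul_eq_mul]
  -- (5) the excess is at most half the active burn
  have hexcess : (m : ℝ) * (Q ^ 2 / P) ≤ (δ ^ 2 / 2) * lam ^ ((2 / 5 : ℝ) * ((n : ℝ) + 1)) := by
    have e1 : (m : ℝ) * (Q ^ 2 / P) = ((m : ℝ) * K ^ 2 * (m : ℝ) ^ 4 * lam ^ (-(6 / 5 : ℝ)) * δ ^ 2)
        * δ ^ 2 * lam ^ ((2 / 5 : ℝ) * ((n : ℝ) + 1)) := by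
      rw [hQdef, hPdef, div_eq_mul_inv, ← Real.rpow_neg hlam0.le]
      have e2 : (lam ^ ((3 / 5 : ℝ) * n)) ^ 2 * lam ^ (-((4 / 5 : ℝ) * ((n : ℝ) + 1)))
          = lam ^ (-(6 / 5 : ℝ)) * lam ^ ((2 / 5 : ℝ) * ((n : ℝ) + 1)) := by
        rw [← Real.rpow_natCast, ← Real.rpow_mul hlam0.le, valveBudget_rpow_mul_rpow hlam0,
          valveBudget_rpow_mul_rpow hlam0]
        congr 1; push_cast; ring
      calc (m : ℝ) * ((K * (m : ℝ) ^ 2 * δ ^ 2 * lam ^ ((3 / 5 : ℝ) * n)) ^ 2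
            * lam ^ (-((4 / 5 : ℝ) * ((n : ℝ) + 1))))
          = (m : ℝ) * K ^ 2 * (m : ℝ) ^ 4 * δ ^ 2 * δ ^ 2
              * ((lam ^ ((3 / 5 : ℝ) * n)) ^ 2 * lam ^ (-((4 / 5 : ℝ) * ((n : ℝ) + 1)))) := by ring
        _ = _ := by rw [e2]; ring
    rw [e1]
    have hδ2 : 0 ≤ δ ^ 2 := sq_nonneg _
    have hl : 0 ≤ lam ^ ((2 / 5 : ℝ) * ((n : ℝ) + 1)) := (Real.rpow_pos_of_pos hlam0 _).le
    calc ((m : ℝ) * K ^ 2 * (m : ℝ) ^ 4 * lam ^ (-(6 / 5 : ℝ)) * δ ^ 2) * δ ^ 2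
          * lam ^ ((2 / 5 : ℝ) * ((n : ℝ) + 1))
        ≤ (1 / 2) * δ ^ 2 * lam ^ ((2 / 5 : ℝ) * ((n : ℝ) + 1)) := by gcongr
      _ = (δ ^ 2 / 2) * lam ^ ((2 / 5 : ℝ) * ((n : ℝ) + 1)) := by ring
  -- (6) combine
  have hflux_n := (le_abs_self _).trans (hleak.trans habs)
  have hflux_top := (neg_le_abs _).trans htop
  rw [hg0eq] at hS0
  nlinarith [hS0, hSl, hglS, hact', hflux_n, hflux_top, hexcess, hg0 0, hP,
    Finset.sum_nonneg (fun i (_ : i ∈ (Finset.univ : Finset (Fin m))) => sq_nonneg (X i (n + 1) ξ))]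

end Summit.NavierStokesRegularity.NavierStokesRegularity.Theorems.PerpetualPumpCircuitTrace

end
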